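/-
Copyright (c) 2026 the pub-hodgecm-mathlib formalisation cell (harness21).  Prover seat hodgecm-mathlib-K2E2-p12 (g5): Track B «K2-LIT», ENGINE E1,
h413 = stmt-HodgeConjecture-24833; (q10) «R7₃-SCALAR» FILE 3, brick (3-iv-b) «FINITE PART TRANSPORT» (assembly sub-brick; dealer K2E1-plan (g5) «=» 08:27Z ∕ 08:34Z).
-/
import Summits.HodgeConjecture.HodgeConjecture.Theorems.K2E1IntertwiningFiniteHeightDictionaryU3      -- ★ (3-iv-a): `h_f((X_∞, Ψ^∞(a₀,a₁)), b)^{−σ} = ∏ᶠ_v Q_v^{−σ}` pointwise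
import Summits.HodgeConjecture.HodgeConjecture.Theorems.K2E1IntertwiningScalarEulerProductU3Finite    -- ★ (3-iii-b2): `μ(𝒪̂³)⁻¹ ∫ ∏ᶠ_v Q_v^{−σ} dμ3 = (∏_{S₀} a_v)·N^{S₀}∕D^{S₀}`
import Summits.HodgeConjecture.HodgeConjecture.Theorems.K2E1FiniteAdeleBasisTransport               -- ★ p858520: the CM transport `(𝔸_{L⁺,f})² ≃ₜ+ 𝔸_{L,f}`, `(a₀,a₁) ↦ (a₀) + (a₁)·δ`
import Mathlib.MeasureTheory.Measure.Haar.Unique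
import HarnessLib

/-!
# K2·E1 — `K2E1IntertwiningFiniteTransportU3` ((q10) «R7₃-SCALAR» FILE 3, brick (3-iv-b)): TRANSPORT OF THE FINITE PART — `∫_{(𝔸_{L⁺,f})³} G(Ψ^∞(x₀,x₁), x₂) dμ³ =
# C·∫_{𝔸_{L,f}×𝔸_{L⁺,f}} G d(μ_{L,f}⊗μ_{L⁺,f})` FOR EVERY `G`, AND THE FINITE-ADELIC DOUBLE INTEGRAL OF `h_f^{−σ}` AS `C'·μ³(𝒪̂³)·(∏_{S₀} a_v)·N^{S₀}(σ)∕D^{S₀}(σ)`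

Track B ∕ K2-LIT, crux h413 = `stmt-HodgeConjecture-24833`, route of record `HCCMUnconditional`; cell `hodgecm-mathlib`, squad K2, ENGINE E1 (campaign «EIS-RANK-ONE», R7 at
`N = 3`).  THEOREMS ONLY (no `def`, no instance, no notation, no `sorry`; default heartbeats); lane `--supports stmt-HodgeConjecture-24833 --as helper` (count-neutral).
* §1 **`exists_pos_integral_pi_three_eq_smul_integral_prod`** — ONE constant `C > 0` (Haar uniqueness on `𝔸_{L,f}` through ★ p858520's CM transport, Mathlib
  `measurePreserving_piFinSuccAbove`, `measurePreserving_swap`, `Measure.map_prod_map`) with, for EVERY `G : 𝔸_{L,f} → 𝔸_{L⁺,f} → ℂ`,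
  `∫_{x ∈ (𝔸_{L⁺,f})³} G(Ψ^∞(x 0, x 1), x 2) dμ³ = C • ∫_{(X, b)} G X b d(μ_{L,f} ⊗ μ_{L⁺,f})` and `G(Ψ^∞(·,·), ·) ∈ L¹(μ³) ⟺ G ∈ L¹(μ_{L,f} ⊗ μ_{L⁺,f})` (`μ³ = ⊗³ μ_{L⁺,f}`).
* §2 **`exists_pos_integral_prod_heightFactor_rpow_eq`** (HEAD): ONE constant `C' > 0` with, for every real `σ > 2`, every archimedean parameter `X_∞` and every bad finset `S₀`
  (`hgood` off `S₀`), IF `(X, b) ↦ h_f((X_∞, X), b)^{−σ}` is `μ_{L,f} ⊗ μ_{L⁺,f}`-integrable THEN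
  `∫ ((h_f((X_∞,X), b)^{−σ} : ℝ) : ℂ) d(μ_{L,f}⊗μ_{L⁺,f}) = C' · μ³(𝒪̂³) · (∏_{v ∈ S₀} a_v(σ)) · N^{S₀}(σ)∕D^{S₀}(σ)` — ★ (3-iv-a) pointwise + §1 + ★ (3-iii-b2); `a_v(σ)` the normalised
  local means of ★ (3-iii-b2), `N^{S₀}∕D^{S₀}` its `partialStandardL` value VERBATIM.
HONEST LABEL: HC_CM is proved only modulo the 7 printed citations (2 remaining named inputs: hLiu418 = `stmt-HodgeConjecture-24832`, h413 = `stmt-HodgeConjecture-24833`) until rung 0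
closes; this file asserts no named fact and closes no socket; count-neutral; §2 is conditional only on its displayed letters (`hgood`, the finite integrability `hfin`).

## References
* [WeilBNT1967] A. Weil, *Basic Number Theory* (1967): Ch. IV §1 (Haar measure under isomorphisms).
* [TateThesis1967] J. Tate, *Fourier analysis in number fields and Hecke's zeta-functions* (1967): §3.3, Thm 3.3.1.
* [CasselsFrohlichANT1967] J. W. S. Cassels, A. Fröhlich (eds.), *Algebraic Number Theory* (1967): Ch. II §14.
* [Langlands1971] R. P. Langlands, *Euler Products* (1971): §3.
-/

set_option autoImplicit false
set_option linter.dupNamespace false -- the mandated namespace repeats `HodgeConjecture.HodgeConjecture`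

noncomputable section

open MeasureTheory MeasureTheory.Measure NumberField IsDedekindDomain Filter
open scoped NNReal ENNReal
open Literature.NumberTheory.Automorphic Literature.NumberTheory.Automorphic.UnitaryGroup Literature.NumberTheory.GaloisRepresentations
open Literature.NumberTheory.GaloisRepresentations.IsNonarchimedeanLocalField
open Summit.HodgeConjecture.HodgeConjecture.Cruxes.H413.K2E1FiniteAdeleBasisTransport (exists_continuousAddEquiv_one_delta)
open Summit.HodgeConjecture.HodgeConjecture.Cruxes.H413.K2E1IntertwiningFiniteHeightDictionaryU3 (ofReal_coe_finprod_heightFactor_rpow_neg_eq)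
open Summit.HodgeConjecture.HodgeConjecture.Cruxes.H413.K2E1IntertwiningScalarEulerProductU3Finite (integral_finprod_eq_measure_mul_prod_mul_eulerProduct_three)

namespace Summit.HodgeConjecture.HodgeConjecture.Cruxes.H413.K2E1IntertwiningFiniteTransportU3

variable (L : Type) [Field L] [NumberField L] [IsCMField L] {δ : L}
  [MeasurableSpace (FiniteAdeleRing (𝓞 ↥(maximalRealSubfield L)) ↥(maximalRealSubfield L))] [BorelSpace (FiniteAdeleRing (𝓞 ↥(maximalRealSubfield L)) ↥(maximalRealSubfield L))]
  [MeasurableSpace (FiniteAdeleRing (𝓞 L) L)] [BorelSpace (FiniteAdeleRing (𝓞 L) L)]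
  (μFf : Measure (FiniteAdeleRing (𝓞 ↥(maximalRealSubfield L)) ↥(maximalRealSubfield L))) [μFf.IsAddHaarMeasure]
  (μEf : Measure (FiniteAdeleRing (𝓞 L) L)) [μEf.IsAddHaarMeasure]

/-! ## §1 The change of variables `(𝔸_{L⁺,f})³ → 𝔸_{L,f} × 𝔸_{L⁺,f}`, `x ↦ (Ψ^∞(x 0, x 1), x 2)` -/

/-- **TRANSPORT OF THE FINITE PART**: there is ONE constant `C > 0` such that for EVERY `G : 𝔸_{L,f} → 𝔸_{L⁺,f} → ℂ`,
`∫_{(𝔸_{L⁺,f})³} G(Ψ^∞(x 0, x 1), x 2) dμ³(x) = C • ∫ G(X, b) d(μ_{L,f} ⊗ μ_{L⁺,f})(X, b)` and `x ↦ G(Ψ^∞(x 0, x 1), x 2) ∈ L¹(μ³) ⟺ (X,b) ↦ G(X,b) ∈ L¹(μ_{L,f} ⊗ μ_{L⁺,f})`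
(`μ³ = μ_{L⁺,f}^{⊗3}`; `Ψ^∞(a₀,a₁) = (a₀) + (a₁)·δ` = ★ `quadraticFiniteAdeleMap` = ★ p858520's homeomorphic CM transport, whose push-forward of `μ_{L⁺,f}^{⊗2}` is `C • μ_{L,f}` by Haar
uniqueness; `(Fin 3 → ·) ≃ᵐ · × (Fin 2 → ·)` is Mathlib `piFinSuccAbove`). [cite: WeilBNT1967, Ch. IV §1] [cite: CasselsFrohlichANT1967, Ch. II §14] [cite: TateThesis1967, §3.3] -/
theorem exists_pos_integral_pi_three_eq_smul_integral_prod (hcδ : IsCMField.complexConj L δ = -δ) (hδ : δ ≠ 0) :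
    ∃ C : ℝ≥0, 0 < C ∧ ∀ G : FiniteAdeleRing (𝓞 L) L → FiniteAdeleRing (𝓞 ↥(maximalRealSubfield L)) ↥(maximalRealSubfield L) → ℂ,
      (∫ x : Fin 3 → FiniteAdeleRing (𝓞 ↥(maximalRealSubfield L)) ↥(maximalRealSubfield L),
          G (quadraticFiniteAdeleMap ↥(maximalRealSubfield L) L δ (x 0, x 1)) (x 2) ∂(Measure.pi fun _ : Fin 3 => μFf) =
        (C : ℝ) • ∫ q : FiniteAdeleRing (𝓞 L) L × FiniteAdeleRing (𝓞 ↥(maximalRealSubfield L)) ↥(maximalRealSubfield L), G q.1 q.2 ∂(μEf.prod μFf)) ∧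
      (Integrable (fun x : Fin 3 → FiniteAdeleRing (𝓞 ↥(maximalRealSubfield L)) ↥(maximalRealSubfield L) =>
          G (quadraticFiniteAdeleMap ↥(maximalRealSubfield L) L δ (x 0, x 1)) (x 2)) (Measure.pi fun _ : Fin 3 => μFf) ↔
        Integrable (fun q : FiniteAdeleRing (𝓞 L) L × FiniteAdeleRing (𝓞 ↥(maximalRealSubfield L)) ↥(maximalRealSubfield L) => G q.1 q.2) (μEf.prod μFf)) := by
  haveI : SecondCountableTopology (FiniteAdeleRing (𝓞 ↥(maximalRealSubfield L)) ↥(maximalRealSubfield L)) := secondCountableTopology_finiteAdeleRing _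
  haveI : SecondCountableTopology (FiniteAdeleRing (𝓞 L) L) := secondCountableTopology_finiteAdeleRing L
  haveI : LocallyCompactSpace (FiniteAdeleRing (𝓞 ↥(maximalRealSubfield L)) ↥(maximalRealSubfield L)) := locallyCompactSpace_finiteAdeleRing' _
  haveI : LocallyCompactSpace (FiniteAdeleRing (𝓞 L) L) := locallyCompactSpace_finiteAdeleRing' L
  haveI : Algebra.IsQuadraticExtension ↥(maximalRealSubfield L) L := IsCMField.isQuadraticExtension L
  obtain ⟨e, he⟩ := exists_continuousAddEquiv_one_delta (F := ↥(maximalRealSubfield L)) (E := L) (IsCMField.complexConj L) hcδ hδ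
  -- Haar uniqueness: `e_* μ² = C • μ_{L,f}`
  set μ2 : Measure (Fin 2 → FiniteAdeleRing (𝓞 ↥(maximalRealSubfield L)) ↥(maximalRealSubfield L)) := Measure.pi fun _ => μFf with hμ2
  haveI : (μ2.map e).IsAddHaarMeasure := e.isAddHaarMeasure_map μ2
  obtain ⟨C, hCpos, hc⟩ : ∃ C : ℝ≥0, 0 < C ∧ μ2.map e = C • μEf :=
    ⟨Measure.addHaarScalarFactor (μ2.map e) μEf, Measure.addHaarScalarFactor_pos_of_isAddHaarMeasure _ _, Measure.isAddLeftInvariant_eq_smul _ _⟩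
  refine ⟨C, hCpos, fun G => ?_⟩
  -- the composite measurable equivalence `Φ : (Fin 3 → 𝔸_{L⁺,f}) ≃ᵐ 𝔸_{L,f} × 𝔸_{L⁺,f}`, `x ↦ (e (x 0, x 1), x 2)`
  set eP : (Fin 2 → FiniteAdeleRing (𝓞 ↥(maximalRealSubfield L)) ↥(maximalRealSubfield L)) × FiniteAdeleRing (𝓞 ↥(maximalRealSubfield L)) ↥(maximalRealSubfield L) ≃ᵐ
      FiniteAdeleRing (𝓞 L) L × FiniteAdeleRing (𝓞 ↥(maximalRealSubfield L)) ↥(maximalRealSubfield L) :=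
    MeasurableEquiv.prodCongr e.toHomeomorph.toMeasurableEquiv (MeasurableEquiv.refl _) with heP
  set Φ := ((MeasurableEquiv.piFinSuccAbove (fun _ : Fin 3 => FiniteAdeleRing (𝓞 ↥(maximalRealSubfield L)) ↥(maximalRealSubfield L)) 2).trans
    MeasurableEquiv.prodComm).trans eP with hΦ
  have hme : Measurable (e : (Fin 2 → FiniteAdeleRing (𝓞 ↥(maximalRealSubfield L)) ↥(maximalRealSubfield L)) → FiniteAdeleRing (𝓞 L) L) :=
    e.continuous.measurable
  have hPmap : (μ2.prod μFf).map eP = C • μEf.prod μFf := by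
    rw [show (eP : _ → FiniteAdeleRing (𝓞 L) L × FiniteAdeleRing (𝓞 ↥(maximalRealSubfield L)) ↥(maximalRealSubfield L)) =
        Prod.map (e : (Fin 2 → FiniteAdeleRing (𝓞 ↥(maximalRealSubfield L)) ↥(maximalRealSubfield L)) → FiniteAdeleRing (𝓞 L) L) id from rfl,
      ← Measure.map_prod_map μ2 μFf hme measurable_id, hc, Measure.map_id, Measure.prod_smul_left]
  have hΦm : MeasurePreserving Φ (Measure.pi fun _ : Fin 3 => μFf) (C • μEf.prod μFf) := by
    rw [hΦ]
    refine ((measurePreserving_piFinSuccAbove (fun _ : Fin 3 => μFf) 2).trans ?_).trans ⟨eP.measurable, hPmap⟩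
    exact measurePreserving_swap
  -- pointwise: `G((Φ x).1, (Φ x).2) = G(Ψ^∞(x 0, x 1), x 2)`
  have hpt : ∀ x : Fin 3 → FiniteAdeleRing (𝓞 ↥(maximalRealSubfield L)) ↥(maximalRealSubfield L),
      G (Φ x).1 (Φ x).2 = G (quadraticFiniteAdeleMap ↥(maximalRealSubfield L) L δ (x 0, x 1)) (x 2) := by
    intro x
    have h0 : Fin.succAbove (2 : Fin 3) 0 = 0 := by decide
    have h1 : Fin.succAbove (2 : Fin 3) 1 = 1 := by decide
    show G (e fun j : Fin 2 => x (Fin.succAbove 2 j)) (x 2) = _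
    rw [he, quadraticFiniteAdeleMap_apply, h0, h1]
  have hfun : (fun x : Fin 3 → FiniteAdeleRing (𝓞 ↥(maximalRealSubfield L)) ↥(maximalRealSubfield L) =>
      G (quadraticFiniteAdeleMap ↥(maximalRealSubfield L) L δ (x 0, x 1)) (x 2)) =
      (fun q : FiniteAdeleRing (𝓞 L) L × FiniteAdeleRing (𝓞 ↥(maximalRealSubfield L)) ↥(maximalRealSubfield L) => G q.1 q.2) ∘ Φ :=
    funext fun x => (hpt x).symm
  have hC0 : (C : ℝ≥0∞) ≠ 0 := ENNReal.coe_ne_zero.2 hCpos.ne'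
  refine ⟨?_, ?_⟩
  · have key := hΦm.integral_comp' (fun q : FiniteAdeleRing (𝓞 L) L × FiniteAdeleRing (𝓞 ↥(maximalRealSubfield L)) ↥(maximalRealSubfield L) => G q.1 q.2)
    calc ∫ x : Fin 3 → FiniteAdeleRing (𝓞 ↥(maximalRealSubfield L)) ↥(maximalRealSubfield L),
          G (quadraticFiniteAdeleMap ↥(maximalRealSubfield L) L δ (x 0, x 1)) (x 2) ∂(Measure.pi fun _ : Fin 3 => μFf)
        = ∫ x : Fin 3 → FiniteAdeleRing (𝓞 ↥(maximalRealSubfield L)) ↥(maximalRealSubfield L), G (Φ x).1 (Φ x).2 ∂(Measure.pi fun _ : Fin 3 => μFf) :=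
          integral_congr_ae (Eventually.of_forall fun x => (hpt x).symm)
      _ = ∫ q, G q.1 q.2 ∂(C • μEf.prod μFf) := key
      _ = _ := integral_smul_nnreal_measure _ _
  · rw [hfun, hΦm.integrable_comp_emb Φ.measurableEmbedding]
    exact integrable_smul_measure hC0 ENNReal.coe_ne_top

/-! ## §2 HEAD: the finite-adelic double integral of `h_f^{−σ}` is `C'·μ³(𝒪̂³)·(∏_{S₀} a_v)·N^{S₀}∕D^{S₀}` -/

/-- **THE FINITE PART OF THE `U(2,1)` INTERTWINING INTEGRAL AT THE CM PAIR, AS AN EULER PRODUCT** (`σ > 2` real): there is ONE constant `C' > 0` (the CM transport constant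
of §1, inverted) such that for every archimedean parameter `X_∞`, every bad finset `S₀` with `hgood` off `S₀`, every `σ > 2`, IF `(X, b) ↦ h_f((X_∞, X), b)^{−σ}` is
`μ_{L,f} ⊗ μ_{L⁺,f}`-integrable THEN `∫ ((h_f((X_∞,X),b)^{−σ} : ℝ) : ℂ) d(μ_{L,f} ⊗ μ_{L⁺,f}) = C'·μ³(𝒪̂³)·(∏_{v ∈ S₀} a_v(σ))·N^{S₀}(σ)∕D^{S₀}(σ)` — §1 at
`G = h_f^{−σ}`, ★ (3-iv-a) `ofReal_coe_finprod_heightFactor_rpow_neg_eq` pointwise, ★ (3-iii-b2) `integral_finprod_eq_measure_mul_prod_mul_eulerProduct_three` (`h_f` = ★ (a2)₃'s finite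
height factor VERBATIM at `X = (X_∞, X)`; `a_v(σ)`, `N^{S₀}∕D^{S₀}` = ★ (3-iii-b2)'s VERBATIM, `ε = quadraticHeckeCharCM L`).
[cite: TateThesis1967, Thm 3.3.1] [cite: Langlands1971, §3] [cite: WeilBNT1967, Ch. IV §1] -/
theorem exists_pos_integral_prod_heightFactor_rpow_eq (hcδ : IsCMField.complexConj L δ = -δ) (hδ : δ ≠ 0) {d : ↥(maximalRealSubfield L)} (hd : δ * δ = algebraMap ↥(maximalRealSubfield L) L d)
    [∀ v : HeightOneSpectrum (𝓞 ↥(maximalRealSubfield L)), MeasurableSpace (v.adicCompletion ↥(maximalRealSubfield L))] [∀ v : HeightOneSpectrum (𝓞 ↥(maximalRealSubfield L)), BorelSpace (v.adicCompletion ↥(maximalRealSubfield L))]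
    (νv : ∀ v : HeightOneSpectrum (𝓞 ↥(maximalRealSubfield L)), Measure (v.adicCompletion ↥(maximalRealSubfield L))) [∀ v, (νv v).IsAddHaarMeasure] :
    ∃ C' : ℝ≥0, 0 < C' ∧ ∀ (Xinf : InfiniteAdeleRing L) (S₀ : Finset (HeightOneSpectrum (𝓞 ↥(maximalRealSubfield L))))
      (hgood : ∀ v ∉ S₀, Algebra.IsUnramifiedIn (𝓞 L) v.asIdeal ∧ Valued.v (2 : v.adicCompletion ↥(maximalRealSubfield L)) = 1 ∧
        ∀ w : PlacesOver L v, Valued.v (algebraMap L (LocalRing L v) δ w) = 1) {σ : ℝ} (hσ : 2 < σ)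
      (hfin : Integrable (fun q : FiniteAdeleRing (𝓞 L) L × FiniteAdeleRing (𝓞 ↥(maximalRealSubfield L)) ↥(maximalRealSubfield L) =>
        ((((∏ᶠ w : HeightOneSpectrum (𝓞 L), max 1 (max ‖((Xinf, q.1) : AdeleRing (𝓞 L) L).2 w‖₊
              ‖(heisZ (c := IsCMField.complexConj L) ((Xinf, q.1) : AdeleRing (𝓞 L) L)
                ((traceZeroLine ↥(maximalRealSubfield L) L (IsCMField.complexConj L) hcδ hδ
                  ((0, q.2) : AdeleRing (𝓞 ↥(maximalRealSubfield L)) ↥(maximalRealSubfield L)) :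
                    traceZeroAdele ↥(maximalRealSubfield L) L (IsCMField.complexConj L)) : AdeleRing (𝓞 L) L)).2 w‖₊) : ℝ≥0) : ℝ) ^ (-σ) : ℝ) : ℂ)) (μEf.prod μFf)),
      ∫ q : FiniteAdeleRing (𝓞 L) L × FiniteAdeleRing (𝓞 ↥(maximalRealSubfield L)) ↥(maximalRealSubfield L),
          ((((∏ᶠ w : HeightOneSpectrum (𝓞 L), max 1 (max ‖((Xinf, q.1) : AdeleRing (𝓞 L) L).2 w‖₊
              ‖(heisZ (c := IsCMField.complexConj L) ((Xinf, q.1) : AdeleRing (𝓞 L) L)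
                ((traceZeroLine ↥(maximalRealSubfield L) L (IsCMField.complexConj L) hcδ hδ
                  ((0, q.2) : AdeleRing (𝓞 ↥(maximalRealSubfield L)) ↥(maximalRealSubfield L)) :
                    traceZeroAdele ↥(maximalRealSubfield L) L (IsCMField.complexConj L)) : AdeleRing (𝓞 L) L)).2 w‖₊) : ℝ≥0) : ℝ) ^ (-σ) : ℝ) : ℂ) ∂(μEf.prod μFf) =
        (C' : ℂ) * ((((Measure.pi fun _ : Fin 3 => μFf) (offBox (K := ↥(maximalRealSubfield L)) (ι := Fin 3) ∅)).toReal : ℂ) *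
          ((∏ v ∈ S₀, ((Measure.pi fun _ : Fin 3 => νv v) (integralBox ↥(maximalRealSubfield L) (Fin 3) v)).toReal⁻¹ •
              ∫ p : Fin 3 → v.adicCompletion ↥(maximalRealSubfield L),
                (((∏ w' : PlacesOver L v, max 1 (max ((normAbs (w'.1.adicCompletion L) (quadraticLocalEquiv L v (IsCMField.complexConj L) hcδ hδ (p 0, p 1) w') : ℝ≥0) : ℝ)
                  ((normAbs (w'.1.adicCompletion L) ((toLocalRing L v (p 2) * algebraMap L (LocalRing L v) δ -
                    toLocalRing L v 2⁻¹ * (quadraticLocalEquiv L v (IsCMField.complexConj L) hcδ hδ (p 0, p 1) *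
                      conjLocal L (IsCMField.complexConj L) v (quadraticLocalEquiv L v (IsCMField.complexConj L) hcδ hδ (p 0, p 1)))) w') : ℝ≥0) : ℝ))) ^ (-σ) : ℝ) : ℂ)
                ∂(Measure.pi fun _ : Fin 3 => νv v)) *
            ((partialStandardL (↑S₀ : Set (HeightOneSpectrum (𝓞 ↥(maximalRealSubfield L)))) (fun _ => {1}) ((σ : ℂ) - 1) * partialStandardL (↑S₀ : Set (HeightOneSpectrum (𝓞 ↥(maximalRealSubfield L)))) (fun v => {(quadraticHeckeCharCM L).valueAtUniformizer v}) ((σ : ℂ) - 1) *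
                partialStandardL (↑S₀ : Set (HeightOneSpectrum (𝓞 ↥(maximalRealSubfield L)))) (fun v => {(quadraticHeckeCharCM L).valueAtUniformizer v}) (2 * (σ : ℂ) - 2)) /
              (partialStandardL (↑S₀ : Set (HeightOneSpectrum (𝓞 ↥(maximalRealSubfield L)))) (fun _ => {1}) (σ : ℂ) * partialStandardL (↑S₀ : Set (HeightOneSpectrum (𝓞 ↥(maximalRealSubfield L)))) (fun v => {(quadraticHeckeCharCM L).valueAtUniformizer v}) (σ : ℂ) *
                partialStandardL (↑S₀ : Set (HeightOneSpectrum (𝓞 ↥(maximalRealSubfield L)))) (fun v => {(quadraticHeckeCharCM L).valueAtUniformizer v}) (2 * (σ : ℂ) - 1))))) := by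
  haveI : SecondCountableTopology (FiniteAdeleRing (𝓞 ↥(maximalRealSubfield L)) ↥(maximalRealSubfield L)) := secondCountableTopology_finiteAdeleRing _
  haveI : LocallyCompactSpace (FiniteAdeleRing (𝓞 ↥(maximalRealSubfield L)) ↥(maximalRealSubfield L)) := locallyCompactSpace_finiteAdeleRing' _
  obtain ⟨C, hC, hall⟩ := exists_pos_integral_pi_three_eq_smul_integral_prod L μFf μEf hcδ hδ
  refine ⟨C⁻¹, inv_pos.2 hC, fun Xinf S₀ hgood σ hσ hfin => ?_⟩
  obtain ⟨hval, hiff⟩ := hall fun X b => ((((∏ᶠ w : HeightOneSpectrum (𝓞 L), max 1 (max ‖((Xinf, X) : AdeleRing (𝓞 L) L).2 w‖₊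
              ‖(heisZ (c := IsCMField.complexConj L) ((Xinf, X) : AdeleRing (𝓞 L) L)
                ((traceZeroLine ↥(maximalRealSubfield L) L (IsCMField.complexConj L) hcδ hδ
                  ((0, b) : AdeleRing (𝓞 ↥(maximalRealSubfield L)) ↥(maximalRealSubfield L)) :
                    traceZeroAdele ↥(maximalRealSubfield L) L (IsCMField.complexConj L)) : AdeleRing (𝓞 L) L)).2 w‖₊) : ℝ≥0) : ℝ) ^ (-σ) : ℝ) : ℂ)
  -- pointwise ★ (3-iv-a): the transported integrand is the Euler product of the local integrands
  have hpt : (fun x : Fin 3 → FiniteAdeleRing (𝓞 ↥(maximalRealSubfield L)) ↥(maximalRealSubfield L) =>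
      ((((∏ᶠ w : HeightOneSpectrum (𝓞 L), max 1 (max ‖((Xinf, quadraticFiniteAdeleMap ↥(maximalRealSubfield L) L δ (x 0, x 1)) : AdeleRing (𝓞 L) L).2 w‖₊
              ‖(heisZ (c := IsCMField.complexConj L) ((Xinf, quadraticFiniteAdeleMap ↥(maximalRealSubfield L) L δ (x 0, x 1)) : AdeleRing (𝓞 L) L)
                ((traceZeroLine ↥(maximalRealSubfield L) L (IsCMField.complexConj L) hcδ hδ
                  ((0, x 2) : AdeleRing (𝓞 ↥(maximalRealSubfield L)) ↥(maximalRealSubfield L)) :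
                    traceZeroAdele ↥(maximalRealSubfield L) L (IsCMField.complexConj L)) : AdeleRing (𝓞 L) L)).2 w‖₊) : ℝ≥0) : ℝ) ^ (-σ) : ℝ) : ℂ)) =
      fun x : Fin 3 → FiniteAdeleRing (𝓞 ↥(maximalRealSubfield L)) ↥(maximalRealSubfield L) =>
        ∏ᶠ v : HeightOneSpectrum (𝓞 ↥(maximalRealSubfield L)),
            (((∏ w' : PlacesOver L v, max 1 (max ((normAbs (w'.1.adicCompletion L) (quadraticLocalEquiv L v (IsCMField.complexConj L) hcδ hδ (x 0 v, x 1 v) w') : ℝ≥0) : ℝ)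
              ((normAbs (w'.1.adicCompletion L) ((toLocalRing L v (x 2 v) * algebraMap L (LocalRing L v) δ -
                toLocalRing L v 2⁻¹ * (quadraticLocalEquiv L v (IsCMField.complexConj L) hcδ hδ (x 0 v, x 1 v) *
                  conjLocal L (IsCMField.complexConj L) v (quadraticLocalEquiv L v (IsCMField.complexConj L) hcδ hδ (x 0 v, x 1 v)))) w') : ℝ≥0) : ℝ))) ^ (-σ) : ℝ) : ℂ) :=
    funext fun x => ofReal_coe_finprod_heightFactor_rpow_neg_eq L hcδ hδ Xinf (x 0) (x 1) (x 2) σ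
  rw [hpt] at hval hiff
  have h3 := integral_finprod_eq_measure_mul_prod_mul_eulerProduct_three L hcδ hδ hd (Measure.pi fun _ : Fin 3 => μFf) νv S₀ hgood hσ (hiff.2 hfin)
  rw [h3, Complex.real_smul] at hval
  -- `C • I = RHS` ⟹ `I = C⁻¹ • RHS`
  have hC0 : (C : ℂ) ≠ 0 := by exact_mod_cast hC.ne'
  rw [← inv_mul_eq_iff_eq_mul₀ hC0] at hval
  rw [← hval, NNReal.coe_inv, Complex.ofReal_inv]

end Summit.HodgeConjecture.HodgeConjecture.Cruxes.H413.K2E1IntertwiningFiniteTransportU3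

end
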